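import Summits.Ventures.PercRepro.RankLevelSetStarPlusNullity

/-! # RankLevelSetStarPlusCircuits — THE PER-CIRCUIT REFLECTION FOR CIRCUITS WITH `#K ≥ i`, AND (★★)⁺ AT LEVEL `4`
AT EVERY ELEMENT ON NO TRIANGLE (night-1 g36; dossier §48.19; on `RankLevelSetStarPlusNullity`)

Without any nullity bound: the members of a circuit class `K` at level `i` exist only if the bi-independent `i`-set
spans `M✶`, so `rk M✶ ≤ i` and the hyperplane `H = E ∖ K` has dual rank `ρ ≤ i − 1`; the up-shadow chain from
`i − s` to `#E − i − s` closes iff `s ≥ ρ`, which `#K ≥ i` (i.e. `s ≥ i − 1`) gives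
(**`starPlus_perCircuit_of_circuit_ge`**). Summed: **`starPlus_of_coloopFree_of_circuits`** — on a coloop-free
matroid at an element `y` in no parallel pair, `A^y_i ≤ A^y_{#E − i}` whenever every absorbing `i`-set has a circuit
of `y` with `≥ i` elements — and **`starPlus_four_of_no_triangle`**: the reflection at level `4` at every element
through no triangle (`8 < #E`). This is the (★★)⁺ analogue of `perElemAt_of_coloopFree_of_circuits`. Every
declaration has a docstring; imports: the cell's own modules and Mathlib only. Axioms: standard. -/

namespace PercRepro

open Set Matroid

variable {α : Type} (M : Matroid α) [M.Finite]

/-! ## The per-circuit reflection for long circuits -/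

/-- **THE PER-CIRCUIT REFLECTION FOR A CIRCUIT WITH `#K ≥ i`** (coloop-free `M`, `y` in no parallel pair, `3 ≤ i`,
`2i < #E`): `#members(K, i) ≤ #members(K, #E − i)` — `rk M✶ ≤ i` as `Z₀` spans `M✶`, so the hyperplane has rank
`ρ ≤ i − 1 ≤ s` and the up-shadow chain from `i − s` to `#E − i − s` closes. -/
theorem starPlus_perCircuit_of_circuit_ge (hcol : ∀ e, ¬ M.IsColoop e) {y : α} (hy : y ∈ M.E)
    (hnp : ∀ z, z ≠ y → y ∉ M.closure {z}) {i : ℕ} (hi3 : 3 ≤ i)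
    (hn : 2 * i < M.E.ncard) {Z₀ : Set α} (hZ₀ : Z₀ ∈ lowAbsorbAt M y i) (hK : i ≤ (M.fundCircuit y Z₀).ncard) :
    {Z ∈ lowAbsorbAt M y i | M.fundCircuit y Z = M.fundCircuit y Z₀}.ncard ≤
      {Z ∈ lowAbsorbAt M y (M.E.ncard - i) | M.fundCircuit y Z = M.fundCircuit y Z₀}.ncard := by
  obtain ⟨hKeq, hSZ, hSE, hHE, -, -, hHy, hyH, hnl, -⟩ := circuit_dual_facts M hcol hy hZ₀
  have h1 := members_le_fam M hy hZ₀
  have h2 := fam_le_absorb M hy hZ₀ (M.E.ncard - i - (M.fundCircuit y Z₀ \ {y}).ncard)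
  obtain ⟨z₀, hz₀⟩ : (M.E \ {y}).Nonempty := by
    rw [← Set.ncard_pos (M.ground_finite.subset Set.sdiff_subset), Set.ncard_sdiff_singleton_of_mem hy]
    omega
  have hz₀y : z₀ ≠ y := by simpa using hz₀.2
  have hK3 := (fundCircuit_ncard_absorb M hy hnp hz₀y hZ₀).1
  have hZE : Z₀ ⊆ M.E := hZ₀.1.1
  have hZi : Z₀.ncard = i := hZ₀.1.2.1
  set K := M.fundCircuit y Z₀ with hK'
  set S := K \ {y} with hS
  set H := M.E \ K with hH
  have hyK : y ∈ K := M.mem_fundCircuit y Z₀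
  have hKE : K ⊆ M.E := hKeq ▸ Set.insert_subset hy hSE
  have hKfin : K.Finite := M.ground_finite.subset hKE
  have hKcard : K.ncard = S.ncard + 1 := by
    rw [hS, Set.ncard_sdiff_singleton_of_mem hyK]
    have : 1 ≤ K.ncard := (Set.ncard_pos hKfin).mpr ⟨y, hyK⟩
    omega
  have hKle : K.ncard ≤ M.E.ncard := Set.ncard_le_ncard hKE M.ground_finite
  have hHcard : H.ncard + K.ncard = M.E.ncard := by
    rw [hH, Set.ncard_sdiff hKE hKfin]; omega
  have hsi : S.ncard ≤ i := by
    rw [← hZi]; exact Set.ncard_le_ncard hSZ (M.ground_finite.subset hZE)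
  have hyE' : y ∈ M✶.E := by rwa [Matroid.dual_ground]
  have hHE' : H ⊆ M✶.E := by rwa [Matroid.dual_ground]
  have hSE' : S ⊆ M✶.E := by rwa [Matroid.dual_ground]
  -- `rk M✶ ≤ i` since the bi-independent `i`-set `Z₀` spans `M✶`; so the hyperplane has rank `≤ i − 1 ≤ s`
  have hν : M✶.eRank ≤ ((i : ℕ) : ℕ∞) := by
    have hsp : M✶.Spanning Z₀ := (indep_compl_iff_dual_spanning M hZE).mp hZ₀.1.2.2.2
    rw [← hsp.eRk_eq]
    refine le_trans (M✶.eRk_le_encard Z₀) ?_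
    rw [← (M.ground_finite.subset hZE).cast_ncard_eq, hZi]
  have hρ : M✶.eRk H ≤ ((i - 1 : ℕ) : ℕ∞) := by
    have h : M✶.eRk H + 1 ≤ ((i - 1 : ℕ) : ℕ∞) + 1 := by
      rw [eRk_add_one_eq_eRank_of_spanning_insert hyE' hyH hHy]
      refine le_trans hν ?_
      exact_mod_cast (show i ≤ i - 1 + 1 by omega)
    exact (WithTop.add_le_add_iff_right (by decide)).mp h
  have hs2 : 2 ≤ S.ncard := by omega
  have hsi' : i - 1 ≤ S.ncard := by omega
  set f : ℕ → ℕ := fun j =>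
    {X | X ⊆ H ∧ X.ncard = j ∧ M✶.Spanning (S ∪ X) ∧ M✶.Spanning (insert y (H \ X))}.ncard with hf
  have hchain : f (i - S.ncard) ≤ f (M.E.ncard - i - S.ncard) := by
    have hm : M.E.ncard - i - S.ncard = (i - S.ncard) + (M.E.ncard - 2 * i) := by omega
    rw [hm]
    refine le_of_chain f (c := M.E.ncard - i - (i - 1)) (by omega) ?_
    intro t ht
    have hstep := absorbFam_step (S := S) hHE' hSE' hyE' hyH hHy hnl hρ (by omega)
      (i := i - S.ncard + t) (by omega)
    have e1 : H.ncard - (i - S.ncard + t) - (i - 1 - 1) = M.E.ncard - i - (i - 1) - t := by omega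
    rw [e1] at hstep
    exact hstep
  have e2 : M.E.ncard - i - S.ncard + S.ncard = M.E.ncard - i := by omega
  rw [e2] at h2
  calc {Z ∈ lowAbsorbAt M y i | M.fundCircuit y Z = M.fundCircuit y Z₀}.ncard ≤ f (i - S.ncard) := h1
    _ ≤ f (M.E.ncard - i - S.ncard) := hchain
    _ ≤ _ := h2

/-- **(★★)⁺ AT LEVEL `i ≥ 3` ON A COLOOP-FREE MATROID AT AN ELEMENT IN NO PARALLEL PAIR, WHENEVER EVERY ABSORBING
`i`-SET HAS A CIRCUIT OF `y` WITH `≥ i` ELEMENTS** (`2i < #E`): `A^y_i ≤ A^y_{#E − i}`. -/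
theorem starPlus_of_coloopFree_of_circuits (hcol : ∀ e, ¬ M.IsColoop e) {y : α} (hy : y ∈ M.E)
    (hnp : ∀ z, z ≠ y → y ∉ M.closure {z}) {i : ℕ} (hi3 : 3 ≤ i) (hn : 2 * i < M.E.ncard)
    (hK : ∀ Z₀ ∈ lowAbsorbAt M y i, i ≤ (M.fundCircuit y Z₀).ncard) :
    lowAbsorbCount M y i ≤ lowAbsorbCount M y (M.E.ncard - i) := by
  unfold lowAbsorbCount
  exact absorb_le_of_perCircuit_levels M i (M.E.ncard - i)
    (fun Z₀ hZ₀ => starPlus_perCircuit_of_circuit_ge M hcol hy hnp hi3 hn hZ₀ (hK Z₀ hZ₀))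

/-- **(★★)⁺ AT LEVEL `4` AT EVERY ELEMENT THROUGH NO TRIANGLE** (coloop-free `M`, `y` in no parallel pair and in no
circuit of `3` elements, `8 < #E`): `A^y_4 ≤ A^y_{#E − 4}` — every circuit of `y` has `≥ 3` elements, hence `≥ 4`. -/
theorem starPlus_four_of_no_triangle (hcol : ∀ e, ¬ M.IsColoop e) {y : α} (hy : y ∈ M.E)
    (hnp : ∀ z, z ≠ y → y ∉ M.closure {z}) (htri : ∀ C, M.IsCircuit C → y ∈ C → C.ncard ≠ 3)
    (hn : 8 < M.E.ncard) : lowAbsorbCount M y 4 ≤ lowAbsorbCount M y (M.E.ncard - 4) := by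
  refine starPlus_of_coloopFree_of_circuits M hcol hy hnp (by norm_num) hn ?_
  intro Z₀ hZ₀
  obtain ⟨z₀, hz₀⟩ : (M.E \ {y}).Nonempty := by
    rw [← Set.ncard_pos (M.ground_finite.subset Set.sdiff_subset), Set.ncard_sdiff_singleton_of_mem hy]
    omega
  have hz₀y : z₀ ≠ y := by simpa using hz₀.2
  have h3 := (fundCircuit_ncard_absorb M hy hnp hz₀y hZ₀).1
  have hycl := mem_closure_of_mem_lowAbsorbAt' M hy hZ₀
  obtain ⟨⟨-, -, hZi, -⟩, hyZ, -⟩ := hZ₀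
  have hC : M.IsCircuit (M.fundCircuit y Z₀) := hZi.fundCircuit_isCircuit hycl hyZ
  have hne := htri _ hC (M.mem_fundCircuit y Z₀)
  omega

end PercRepro
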